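import Summits.ValiantsHypothesis.ValiantsHypothesis.Theses.AnyonJets
import Summits.ValiantsHypothesis.ValiantsHypothesis.Theorems.AnyonJetsConstantFreeJetGrowthDefs
import Literature.Computability.AlgebraicComplexity.ConstantFreeNumerals
import HarnessLib

/-!
# AnyonJets — crux `JetConstantElim` (stmt-ValiantsHypothesis-16737), line `birth`:
# calibration of the open stub `stub_multiplierRemoval` (what it follows from, what kills it)

Route `ValiantsHypothesis/AnyonJets`, crux `JetConstantElim` (`CE`), registered line
`Cruxes/JetConstantElim/Lines/birth.lean`. Its fourth stub, `stub_multiplierRemoval` (`MR`), says: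
an INTEGER MULTIPLIER buys at most a `k`-independent polynomial constant-freely on the anyonic
jets, `τ(J_(n,k)) ≤ (τ(M·J_(n,k)) + n + 2)^{b₃}` for all `n`, all `k ≤ log₂ n`, all `M ≥ 1`
(`τ` = `constantFreeComplexity`, `J_(n,k) = Σ_σ sgn σ · C(inv σ, k) · Π_i X_(σ i, i)` — the tree's
`Theorems.AnyonJets.ConstantFreeJetGrowth.jet`, rfl-equal to the route's `let J`). This is the
"VP⁰-with-integer-division" question on an explicit family (Koiran–Perifel 2011, Rem. 4; in
Bürgisser's 2009 terminology: "ultimately easy ⇒ easy" for the jets), conjecture-grade both ways.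

This helper file (no `sorry`, no definitions, no named-fact hypotheses) records, sorry-free, where
the stub sits:

* `multiplierRemoval_of_jetConstantElim` — `CE → MR` (the stub is NECESSARY for the crux:
  `L_ℂ(J) ≤ τ(M·J) + 1`, one scalar gate `1/M`; exponent `b₃ = 2b`).
* `multiplierRemoval_fixedOrder` — every FIXED-order truncation of `MR` (`k ≤ k₀`) follows from
  the route's `JetFlatness` (proved in the tree, `jetFlatness_proof`: `τ(J_(n,k)) ≤
  (n+2)^{4k+c₀}(2k+2)!`) and `n + 2 ≤ τ(M·J) + n + 2`: as for `CE`, the content of `MR` is only the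
  uniformity in `k ≤ log₂ n`.
* `uniformTau_of_cheapMultiples_of_multiplierRemoval` and
  `not_constantFreeJetGrowth_of_uniformTau` — THE NEGATION SIDE: if some multipliers make the
  jets uniformly cheap (`∃ c ∀ n ∀ k ≤ log₂ n ∃ M ≥ 1, τ(M·J_(n,k)) ≤ (n+2)^c` — "the jets are
  uniformly ULTIMATELY easy"), then `MR` turns this into a uniform constant-free bound
  `τ(J_(n,k)) ≤ (n+2)^b` on the window, which REFUTES the sibling crux `ConstantFreeJetGrowth`
  (`CF`); hence `not_multiplierRemoval_of_cheapMultiples_of_cfGrowth`: cheap multiples `∧ CF ⇒ ¬MR`.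
  The only known SOURCE of cheap multiples is a collapse: `τ(PER_n) = n^{O(1)}` gives
  `τ(2^{p(n)} f_n) = n^{O(1)}` for every `VNP⁰` family (Bürgisser 2009 Thm. 2.10 = Koiran 2004
  Thm. 4.3, tree `Burgisser2009_thm210_holds`); the companion file
  `AnyonJetsJetConstantElimMultiplierRemovalPerEasy.lean` carries that out for the jets. No
  unconditional multiplier (in particular no power of `2` read off the route's 2-adic shadow
  `per ≡ Σ_(j<k) (−2)^j J_j (mod 2^k)`, which expresses `2^k ×` the jet TAIL through `per`, i.e.
  transfers hardness the wrong way) is known to make any `M·J_(n,k)` cheaper than `J_(n,k)`.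

Honest framing: calibration lemmas for an OPEN, conjecture-grade stub; neither `MR` nor `¬MR` is
proved; the crux `JetConstantElim` stays open; VP ≠ VNP is NOT proved here.

References: P. Koiran, S. Perifel, *Interpolation in Valiant's theory*, Comput. Complexity 20
(2011), Rem. 4 and Lemma 8–9 (arXiv:0710.0360, p. 8–9); P. Bürgisser, *On defining integers and
proving arithmetic circuit lower bounds*, Comput. Complexity 18 (2009), Thm. 2.10; P. Bürgisser,
*Completeness and Reduction in Algebraic Complexity Theory*, Springer 2000, §2.1 (scalar gates).
-/

noncomputable section

-- single-conjunct layout: Sub = Summit, duplicated namespace component intended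
set_option linter.dupNamespace false

namespace Summit.ValiantsHypothesis.ValiantsHypothesis.Theorems.AnyonJets.JetConstantElim

open MvPolynomial Literature.Computability.AlgebraicComplexity
open Summit.ValiantsHypothesis.ValiantsHypothesis.Theses.AnyonJets
open Summit.ValiantsHypothesis.ValiantsHypothesis.Theorems.AnyonJets.ConstantFreeJetGrowth (jet)

/-! ### The route items and the stub, read through the tree's `jet` (all `Iff.rfl`) -/

/-- `ConstantFreeJetGrowth` with the route's `let J` replaced by the tree's `jet` (rfl). [folklore] -/
theorem constantFreeJetGrowth_iff_jet :
    ConstantFreeJetGrowth ↔ ∀ c : ℕ, ∃ k : ℕ, 1 ≤ k ∧ ∀ n₀ : ℕ, ∃ n : ℕ, n₀ ≤ n ∧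
      n ^ c ≤ constantFreeComplexity (jet n k) :=
  Iff.rfl

/-- `JetConstantElim` with the route's `let J` replaced by the tree's `jet` (rfl). [folklore] -/
theorem jetConstantElim_iff_jet :
    JetConstantElim ↔ ∃ b : ℕ, ∀ n k : ℕ, k ≤ Nat.log 2 n →
      constantFreeComplexity (jet n k) ≤
        (complexity (MvPolynomial.map (Int.castRingHom ℂ) (jet n k)) + n + 2) ^ b :=
  Iff.rfl

/-- `JetFlatness` with the route's `let J` replaced by the tree's `jet` (rfl). [folklore] -/
theorem jetFlatness_iff_jet :
    JetFlatness ↔ ∃ c₀ : ℕ, ∀ n k : ℕ, constantFreeComplexity (jet n k) ≤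
      (n + 2) ^ (4 * k + c₀) * Nat.factorial (2 * k + 2) :=
  Iff.rfl

/-- The registered stub `stub_multiplierRemoval` (signature verbatim on the left) with the `let J`
replaced by the tree's `jet` (rfl). [folklore] -/
theorem multiplierRemoval_iff_jet :
    (let J := fun (n k : ℕ) => (∑ σ : Equiv.Perm (Fin n), MvPolynomial.C (((Equiv.Perm.sign σ : ℤˣ) : ℤ) * (((Finset.univ.filter (fun p : Fin n × Fin n => p.1 < p.2 ∧ σ p.2 < σ p.1)).card.choose k : ℕ) : ℤ)) * ∏ i : Fin n, MvPolynomial.X (σ i, i) : MvPolynomial (Fin n × Fin n) ℤ);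
    ∃ b₃ : ℕ, ∀ n k M : ℕ, k ≤ Nat.log 2 n → 1 ≤ M →
      Literature.Computability.AlgebraicComplexity.constantFreeComplexity (J n k) ≤
        (Literature.Computability.AlgebraicComplexity.constantFreeComplexity ((M : ℤ) • J n k) + n + 2) ^ b₃) ↔
    ∃ b₃ : ℕ, ∀ n k M : ℕ, k ≤ Nat.log 2 n → 1 ≤ M →
      constantFreeComplexity (jet n k) ≤ (constantFreeComplexity ((M : ℤ) • jet n k) + n + 2) ^ b₃ :=
  Iff.rfl

/-! ### Arithmetic -/

/-- `X + 1 ≤ X^2` for `X ≥ 2`. [folklore] -/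
theorem succ_le_sq (X : ℕ) (hX : 2 ≤ X) : X + 1 ≤ X ^ 2 := by nlinarith

/-- `n + 2 ≤ n^2` for `n ≥ 2`. [folklore] -/
theorem add_two_le_sq (n : ℕ) (hn : 2 ≤ n) : n + 2 ≤ n ^ 2 := by nlinarith

/-! ### `MR` is necessary for the crux: `CE → MR` -/

/-- **Complex cost of a jet versus constant-free cost of a multiple**:
`L_ℂ(J_(n,k)) ≤ τ(M·J_(n,k)) + 1` for `M ≥ 1` — base-change a `τ`-optimal integer circuit for
`M·J` to `ℂ` (`L_ℂ(M·J ⊗ ℂ) ≤ τ(M·J)`) and append one scalar gate `× M⁻¹`. [cite: Burgisser2000, §2.1] -/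
theorem complexity_map_le_constantFreeComplexity_smul_succ {σ : Type*} (f : MvPolynomial σ ℤ)
    {M : ℕ} (hM : 1 ≤ M) :
    complexity (MvPolynomial.map (Int.castRingHom ℂ) f) ≤
      constantFreeComplexity ((M : ℤ) • f) + 1 := by
  have hM0 : ((M : ℂ)) ≠ 0 := by exact_mod_cast (show M ≠ 0 by omega)
  -- `map (M • f) = M • map f`, so `map f = M⁻¹ • map (M • f)`
  have hmap : MvPolynomial.map (Int.castRingHom ℂ) ((M : ℤ) • f) =
      (M : ℂ) • MvPolynomial.map (Int.castRingHom ℂ) f := by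
    rw [MvPolynomial.smul_eq_C_mul, map_mul, map_C, MvPolynomial.smul_eq_C_mul]
    simp
  have hf : MvPolynomial.map (Int.castRingHom ℂ) f =
      (M : ℂ)⁻¹ • MvPolynomial.map (Int.castRingHom ℂ) ((M : ℤ) • f) := by
    rw [hmap, inv_smul_smul₀ hM0]
  obtain ⟨P, h1, -, h3, h4⟩ := ArithCircuit.exists_signConst_map_int (k := ℂ) ((M : ℤ) • f)
  have hL : complexity (MvPolynomial.map (Int.castRingHom ℂ) ((M : ℤ) • f)) ≤
      constantFreeComplexity ((M : ℤ) • f) := h4 ▸ ArithCircuit.complexity_le_size h1 h3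
  rw [hf]
  exact (complexity_smul_le_holds _ _).trans (Nat.add_le_add_right hL 1)

/-- **`CE → MR`** (the stub is implied by the crux; exponent `b₃ = 2b`): from
`τ(J) ≤ (L_ℂ(J) + n + 2)^b` and `L_ℂ(J) ≤ τ(M·J) + 1`,
`τ(J) ≤ (τ(M·J) + n + 3)^b ≤ ((τ(M·J) + n + 2)^2)^b`. So a refutation of the stub refutes the
crux. [folklore] -/
theorem multiplierRemoval_of_jetConstantElim (hCE : JetConstantElim) :
    let J := fun (n k : ℕ) => (∑ σ : Equiv.Perm (Fin n), MvPolynomial.C (((Equiv.Perm.sign σ : ℤˣ) : ℤ) * (((Finset.univ.filter (fun p : Fin n × Fin n => p.1 < p.2 ∧ σ p.2 < σ p.1)).card.choose k : ℕ) : ℤ)) * ∏ i : Fin n, MvPolynomial.X (σ i, i) : MvPolynomial (Fin n × Fin n) ℤ);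
    ∃ b₃ : ℕ, ∀ n k M : ℕ, k ≤ Nat.log 2 n → 1 ≤ M →
      Literature.Computability.AlgebraicComplexity.constantFreeComplexity (J n k) ≤
        (Literature.Computability.AlgebraicComplexity.constantFreeComplexity ((M : ℤ) • J n k) + n + 2) ^ b₃ := by
  refine multiplierRemoval_iff_jet.mpr ?_
  rw [jetConstantElim_iff_jet] at hCE
  obtain ⟨b, hb⟩ := hCE
  refine ⟨2 * b, fun n k M hk hM => ?_⟩
  have hL := complexity_map_le_constantFreeComplexity_smul_succ (jet n k) hM
  set T := constantFreeComplexity ((M : ℤ) • jet n k) with hT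
  calc constantFreeComplexity (jet n k)
      ≤ (complexity (MvPolynomial.map (Int.castRingHom ℂ) (jet n k)) + n + 2) ^ b := hb n k hk
    _ ≤ (T + n + 2 + 1) ^ b := Nat.pow_le_pow_left (by omega) _
    _ ≤ ((T + n + 2) ^ 2) ^ b := Nat.pow_le_pow_left (succ_le_sq _ (by omega)) _
    _ = (T + n + 2) ^ (2 * b) := by rw [← pow_mul]

/-! ### Every fixed-order truncation of `MR` is free -/

/-- **Fixed order**: for every `k₀` there is `b₃` with `τ(J_(n,k)) ≤ (τ(M·J_(n,k)) + n + 2)^{b₃}`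
for all `n`, all `k ≤ k₀`, all `M`, from the route's flatness bound `JetFlatness`
(`τ(J_(n,k)) ≤ (n+2)^{4k+c₀}·(2k+2)!`, PROVED in the tree: `Theorems.AnyonJets.jetFlatness_proof`,
taken as a hypothesis here only to keep this file out of that module's import cone) and
`n + 2 ≤ τ(M·J) + n + 2`; witness `b₃ = 4k₀ + c₀ + (2k₀+2)!`. The content of the stub is only the
uniformity in `k ≤ log₂ n`. [folklore] -/
theorem multiplierRemoval_fixedOrder (hF : JetFlatness) (k₀ : ℕ) :
    ∃ b₃ : ℕ, ∀ n k M : ℕ, k ≤ k₀ →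
      constantFreeComplexity (jet n k) ≤ (constantFreeComplexity ((M : ℤ) • jet n k) + n + 2) ^ b₃ := by
  obtain ⟨c₀, hF⟩ := jetFlatness_iff_jet.mp hF
  refine ⟨4 * k₀ + c₀ + Nat.factorial (2 * k₀ + 2), fun n k M hk => ?_⟩
  set X := constantFreeComplexity ((M : ℤ) • jet n k) + n + 2 with hX
  have hX2 : 2 ≤ X := by omega
  have hnX : n + 2 ≤ X := by omega
  have hfac : Nat.factorial (2 * k + 2) ≤ Nat.factorial (2 * k₀ + 2) :=
    Nat.factorial_le (by omega)
  calc constantFreeComplexity (jet n k)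
      ≤ (n + 2) ^ (4 * k + c₀) * Nat.factorial (2 * k + 2) := hF n k
    _ ≤ X ^ (4 * k + c₀) * X ^ Nat.factorial (2 * k + 2) := by
        apply Nat.mul_le_mul (Nat.pow_le_pow_left hnX _)
        exact le_trans (Nat.lt_two_pow_self).le (Nat.pow_le_pow_left hX2 _)
    _ = X ^ (4 * k + c₀ + Nat.factorial (2 * k + 2)) := (pow_add _ _ _).symm
    _ ≤ X ^ (4 * k₀ + c₀ + Nat.factorial (2 * k₀ + 2)) :=
        Nat.pow_le_pow_right (by omega) (by omega)

/-! ### The negation side: cheap multiples `∧ CF` refute `MR` -/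

/-- **Cheap multiples + `MR` ⇒ uniformly cheap jets**: if for some `c` every jet of order
`k ≤ log₂ n` has a multiple `M·J_(n,k)`, `M ≥ 1`, with `τ(M·J_(n,k)) ≤ (n+2)^c` ("uniformly
ultimately easy", Bürgisser 2009), then `MR` (exponent `b₃`) gives `τ(J_(n,k)) ≤ (n+2)^{(c+2)b₃}`
on the whole window. [folklore] -/
theorem uniformTau_of_cheapMultiples_of_multiplierRemoval
    (hC : ∃ c : ℕ, ∀ n k : ℕ, k ≤ Nat.log 2 n →
      ∃ M : ℕ, 1 ≤ M ∧ constantFreeComplexity ((M : ℤ) • jet n k) ≤ (n + 2) ^ c)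
    (hR : ∃ b₃ : ℕ, ∀ n k M : ℕ, k ≤ Nat.log 2 n → 1 ≤ M →
      constantFreeComplexity (jet n k) ≤ (constantFreeComplexity ((M : ℤ) • jet n k) + n + 2) ^ b₃) :
    ∃ b : ℕ, ∀ n k : ℕ, k ≤ Nat.log 2 n → constantFreeComplexity (jet n k) ≤ (n + 2) ^ b := by
  obtain ⟨c, hc⟩ := hC
  obtain ⟨b₃, hb⟩ := hR
  refine ⟨(c + 2) * b₃, fun n k hk => ?_⟩
  obtain ⟨M, hM, hτ⟩ := hc n k hk
  -- `X^c + X ≤ X^(c+2)` for `X = n + 2 ≥ 2`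
  have key : (n + 2) ^ c + (n + 2) ≤ (n + 2) ^ (c + 2) := by
    set P := (n + 2) ^ c with hP
    have h1 : 1 ≤ P := Nat.one_le_pow _ _ (by omega)
    have h3 : P ≤ P * (n + 2) := Nat.le_mul_of_pos_right _ (by omega)
    have h4 : n + 2 ≤ P * (n + 2) := Nat.le_mul_of_pos_left _ h1
    calc P + (n + 2) ≤ P * (n + 2) + P * (n + 2) := add_le_add h3 h4
      _ = P * (n + 2) * 2 := by ring
      _ ≤ P * (n + 2) * (n + 2) := Nat.mul_le_mul_left _ (by omega)
      _ = (n + 2) ^ (c + 2) := by rw [hP]; ring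
  calc constantFreeComplexity (jet n k)
      ≤ (constantFreeComplexity ((M : ℤ) • jet n k) + n + 2) ^ b₃ := hb n k M hk hM
    _ ≤ ((n + 2) ^ c + (n + 2)) ^ b₃ := Nat.pow_le_pow_left (by omega) _
    _ ≤ ((n + 2) ^ (c + 2)) ^ b₃ := Nat.pow_le_pow_left key _
    _ = (n + 2) ^ ((c + 2) * b₃) := by rw [← pow_mul]

/-- **A uniform constant-free bound on the window refutes `CF`**: if `τ(J_(n,k)) ≤ (n+2)^b` for all
`n` and all `k ≤ log₂ n`, then `ConstantFreeJetGrowth` fails (at `c = 2b + 1`: for the `k ≥ 1`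
it provides and `n ≥ max(2^k, 2)`, `n^{2b+1} ≤ τ ≤ (n+2)^b ≤ n^{2b}`). [folklore] -/
theorem not_constantFreeJetGrowth_of_uniformTau
    (hU : ∃ b : ℕ, ∀ n k : ℕ, k ≤ Nat.log 2 n → constantFreeComplexity (jet n k) ≤ (n + 2) ^ b) :
    ¬ ConstantFreeJetGrowth := by
  intro hCF
  rw [constantFreeJetGrowth_iff_jet] at hCF
  obtain ⟨b, hB⟩ := hU
  obtain ⟨k, -, hk⟩ := hCF (2 * b + 1)
  obtain ⟨n, hn, hτ⟩ := hk (max (2 ^ k) 2)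
  have h2k : 2 ^ k ≤ n := le_trans (le_max_left _ _) hn
  have hn2 : 2 ≤ n := le_trans (le_max_right _ _) hn
  have hklog : k ≤ Nat.log 2 n := Nat.le_log_of_pow_le (by norm_num) h2k
  have h1 : n ^ (2 * b + 1) ≤ n ^ (2 * b) :=
    calc n ^ (2 * b + 1) ≤ constantFreeComplexity (jet n k) := hτ
      _ ≤ (n + 2) ^ b := hB n k hklog
      _ ≤ (n ^ 2) ^ b := Nat.pow_le_pow_left (add_two_le_sq n hn2) _
      _ = n ^ (2 * b) := by rw [← pow_mul]
  have h2 : n ^ (2 * b) < n ^ (2 * b + 1) := Nat.pow_lt_pow_right (by omega) (by omega)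
  omega

/-- **What kills the stub** (negation side, kernel form): uniformly cheap multiples of the jets
together with the sibling crux `ConstantFreeJetGrowth` REFUTE `stub_multiplierRemoval`
(signature verbatim under the negation). No unconditional source of cheap multiples is known; the
conditional source `τ(PER) = n^{O(1)}` (Bürgisser 2009, Thm. 2.10) is carried out in the companion
file `AnyonJetsJetConstantElimMultiplierRemovalPerEasy.lean`. [cite: KoiranPerifel2011, Rem. 4] -/
theorem not_multiplierRemoval_of_cheapMultiples_of_cfGrowth
    (hC : ∃ c : ℕ, ∀ n k : ℕ, k ≤ Nat.log 2 n →
      ∃ M : ℕ, 1 ≤ M ∧ constantFreeComplexity ((M : ℤ) • jet n k) ≤ (n + 2) ^ c)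
    (hCF : ConstantFreeJetGrowth) :
    ¬ (let J := fun (n k : ℕ) => (∑ σ : Equiv.Perm (Fin n), MvPolynomial.C (((Equiv.Perm.sign σ : ℤˣ) : ℤ) * (((Finset.univ.filter (fun p : Fin n × Fin n => p.1 < p.2 ∧ σ p.2 < σ p.1)).card.choose k : ℕ) : ℤ)) * ∏ i : Fin n, MvPolynomial.X (σ i, i) : MvPolynomial (Fin n × Fin n) ℤ);
      ∃ b₃ : ℕ, ∀ n k M : ℕ, k ≤ Nat.log 2 n → 1 ≤ M →
        Literature.Computability.AlgebraicComplexity.constantFreeComplexity (J n k) ≤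
          (Literature.Computability.AlgebraicComplexity.constantFreeComplexity ((M : ℤ) • J n k) + n + 2) ^ b₃) :=
  fun hR => not_constantFreeJetGrowth_of_uniformTau
    (uniformTau_of_cheapMultiples_of_multiplierRemoval hC (multiplierRemoval_iff_jet.mp hR)) hCF

/-- The same dichotomy read positively: under `MR`, the sibling crux `CF` forces EVERY multiplier
to be expensive somewhere on the window — for every `c` some jet `J_(n,k)`, `k ≤ log₂ n`, has
`τ(M·J_(n,k)) > (n+2)^c` for ALL `M ≥ 1` ("the jets are not uniformly ultimately easy").
[folklore] -/
theorem multiples_expensive_of_multiplierRemoval_of_cfGrowth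
    (hR : ∃ b₃ : ℕ, ∀ n k M : ℕ, k ≤ Nat.log 2 n → 1 ≤ M →
      constantFreeComplexity (jet n k) ≤ (constantFreeComplexity ((M : ℤ) • jet n k) + n + 2) ^ b₃)
    (hCF : ConstantFreeJetGrowth) (c : ℕ) :
    ∃ n k : ℕ, k ≤ Nat.log 2 n ∧
      ∀ M : ℕ, 1 ≤ M → (n + 2) ^ c < constantFreeComplexity ((M : ℤ) • jet n k) := by
  by_contra h
  push Not at h
  exact not_constantFreeJetGrowth_of_uniformTau
    (uniformTau_of_cheapMultiples_of_multiplierRemoval ⟨c, fun n k hk => by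
      obtain ⟨M, hM, hle⟩ := h n k hk; exact ⟨M, hM, hle⟩⟩ hR) hCF

end Summit.ValiantsHypothesis.ValiantsHypothesis.Theorems.AnyonJets.JetConstantElim

end
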